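import Literature.Algebra.Homology.DoubleComplexExactRows
import HarnessLib

/-!
# The zigzag (collating) formula for `ADoubleComplex.rowColEquiv`

Continuation of `Literature/Algebra/Homology/DoubleComplexExactRows.lean` (Weibel's Acyclic Assembly
Lemma 2.7.3: for an anticommuting first-quadrant double complex `K` with exact rows augmented by `A`
and exact columns augmented by `B`, `rowColEquiv : Hⁿ(A) ≃ Hⁿ(B)`). The comparison isomorphism is
`totEquiv_A ≫ swapTotEquiv ≫ totEquiv_B⁻¹` (both sides are `Hⁿ(Tot)`), so it is computed by
ZIGZAGS (Bott–Tu (1982), Prop. 9.5, "the collating formula" / tic-tac-toe, §8 Ex. 8.7; in Weibel's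
anticommuting conventions): **if the augmented images of cocycles `a ∈ Zⁿ⁺¹(A)` and `b ∈ Zⁿ⁺¹(B)`
differ in the total complex by a total coboundary, `(ε a at (0, n+1)) − (η b at (n+1, 0)) = D x`
with `x` homogeneous of total degree `n`, then `rowColEquiv [a] = [b]`**
(`ADoubleComplex.rowColEquiv_mk_eq_mk_of_totalD`). This is the form in which the Čech–de Rham and
Čech–singular comparisons of an acyclic cover are evaluated on explicit zigzags (a closed form ↦
the Čech cocycle of constants at the end of its zigzag), e.g. for the Čech integrality step of
Lefschetz's theorem on `(1,1)`-classes. Pure homological algebra on the tree's concrete double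
complexes; everything proved (the same statement is recorded Summits-side by route
NikulinTwinTransport, item `LefschetzOneOneK3`, file `…K3CechZigzag`; this is its library home).

## References

* R. Bott, L. W. Tu, *Differential Forms in Algebraic Topology*, GTM 82 (1982), §8 (Ex. 8.7),
  Prop. 9.5. [BottTu1982Forms]
* C. A. Weibel, *An Introduction to Homological Algebra* (1994), Lemma 2.7.3 (proof).
  [Weibel1994]
-/

noncomputable section

open Function Literature.Algebra.Homology Literature.Algebra.Homology.ADoubleComplex

namespace Literature.Algebra.Homology

namespace ADoubleComplex

universe u w w' w''

variable {R : Type u} [CommRing R] {X : ℕ → ℕ → Type w} [∀ p q, AddCommGroup (X p q)]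
  [∀ p q, Module R (X p q)] {K : ADoubleComplex R X}
  {A : ℕ → Type w'} [∀ n, AddCommGroup (A n)] [∀ n, Module R (A n)]
  {B : ℕ → Type w''} [∀ n, AddCommGroup (B n)] [∀ n, Module R (B n)]

/-- Transposition of a single entry: `swap (single p q v) = single q p v`. [folklore] -/
theorem swapₗ_single (p q : ℕ) (v : X p q) :
    swapₗ R (single p q v) = single (X := fun p q ↦ X q p) q p v := by
  funext p' q'
  rw [swapₗ_apply]
  by_cases h : q' = p ∧ p' = q
  · obtain ⟨rfl, rfl⟩ := h
    rw [single_apply_same, single_apply_same]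
  · rw [single_apply_of_ne (by tauto), single_apply_of_ne (by tauto)]

/-- **The zigzag (collating) formula for `rowColEquiv`.** For a row- and column-exact double
complex `K` augmented by `A` (rows, `ε`) and `B` (columns, `η`), cocycles `a ∈ Zⁿ⁺¹(A)`,
`b ∈ Zⁿ⁺¹(B)` and a homogeneous total cochain `x` of degree `n` with
`(ε a at (0, n+1)) − (η b at (n+1, 0)) = D x`, the comparison isomorphism identifies the classes:
`rowColEquiv [a] = [b]` (both map to the same class of `Hⁿ⁺¹(Tot K.swap)`, their difference being the
total coboundary `D (swap x)`). [cite: BottTu1982Forms, Prop. 9.5] [cite: Weibel1994, Lemma 2.7.3 (proof)] -/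
theorem rowColEquiv_mk_eq_mk_of_totalD (E : K.RowAugmentation A) (E' : K.ColAugmentation B)
    (hK : K.RowExact) (hE : E.Exact) (hK' : K.ColExact) (hE' : E'.Exact) {n : ℕ}
    (a : ↥(NatCochain.cocycles E.dA (n + 1))) (b : ↥(NatCochain.cocycles E'.dA (n + 1)))
    (x : ∀ p q, X p q) (hx : x ∈ Tn R n)
    (h : single 0 (n + 1) (E.ε (n + 1) a) - single (n + 1) 0 (E'.ε (n + 1) b) = K.totalD x) :
    rowColEquiv E E' hK hE hK' hE' (n + 1) (NatCochain.Cohomology.mk E.dA (n + 1) a) =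
      NatCochain.Cohomology.mk E'.dA (n + 1) b := by
  rw [rowColEquiv, LinearEquiv.trans_apply, LinearEquiv.trans_apply, LinearEquiv.symm_apply_eq]
  -- both sides in `Hⁿ⁺¹(Tot K.swap)`
  change K.swapTotEquiv (n + 1) (E.totMap (n + 1) (NatCochain.Cohomology.mk E.dA (n + 1) a)) =
    E'.totMap (n + 1) (NatCochain.Cohomology.mk E'.dA (n + 1) b)
  rw [RowAugmentation.totMap_mk, RowAugmentation.totMap_mk, swapTotEquiv,
    NatCochain.Cohomology.equivOfBijective_apply, NatCochain.Cohomology.map_mk,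
    NatCochain.Cohomology.mk_eq_mk_iff, ← mem_coboundaries_totD_iff, totB_succ, Submodule.mem_map]
  refine ⟨swapₗ R x, swapₗ_mem_Tn hx, ?_⟩
  simp only [Submodule.coe_sub, NatCochain.Cohomology.coe_mapCocycles, coe_swapTn,
    RowAugmentation.coe_εTot]
  rw [← K.swapₗ_totalD, ← h, map_sub, swapₗ_single, swapₗ_single]

/-- The same formula with the zigzag written additively: if `ε a at (0, n+1) = η b at (n+1, 0) + D x`
then `rowColEquiv [a] = [b]`. [cite: BottTu1982Forms, Prop. 9.5] -/
theorem rowColEquiv_mk_eq_mk_of_eq_add_totalD (E : K.RowAugmentation A) (E' : K.ColAugmentation B)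
    (hK : K.RowExact) (hE : E.Exact) (hK' : K.ColExact) (hE' : E'.Exact) {n : ℕ}
    (a : ↥(NatCochain.cocycles E.dA (n + 1))) (b : ↥(NatCochain.cocycles E'.dA (n + 1)))
    (x : ∀ p q, X p q) (hx : x ∈ Tn R n)
    (h : single 0 (n + 1) (E.ε (n + 1) a) = single (n + 1) 0 (E'.ε (n + 1) b) + K.totalD x) :
    rowColEquiv E E' hK hE hK' hE' (n + 1) (NatCochain.Cohomology.mk E.dA (n + 1) a) =
      NatCochain.Cohomology.mk E'.dA (n + 1) b :=
  rowColEquiv_mk_eq_mk_of_totalD E E' hK hE hK' hE' a b x hx (by rw [h]; abel)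

end ADoubleComplex

end Literature.Algebra.Homology

end
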